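import Mathlib.NumberTheory.LegendreSymbol.JacobiSymbol
import Mathlib.NumberTheory.Padics.PadicVal.Basic
import Mathlib.Data.Nat.Squarefree
import Mathlib.Algebra.Squarefree.Basic
import Mathlib.RingTheory.Int.Basic
import Mathlib.RingTheory.IntegralClosure.IntegrallyClosed
import Mathlib.Tactic
import HarnessLib

/-!
# Voight 2007, Prop. 3.8 / Cor. 3.9 — arithmetic of the criterion `m · disc ℚ(√(dm)) ∣ D`

Topic `NumberTheory/EllipticCurves/Voight2007` (companion of `RingClassGenusField.lean`, which types
J. Voight, *Quadratic forms that represent almost the same primes*, Math. Comp. 76 (2007), §3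
Prop. 3.8 as the named fact `prop38_sqrt_mem_ringClassField_iff`). THEOREMS only (no definition, no
named fact); pure integer arithmetic used by the proof of that named fact. Voight's criterion for
`ℚ(√m) ⊂ R_(f)` reads `m n ∣ D = d f²` with `n = disc ℚ(√(dm))`, i.e. `d m = n s²`, `n` fundamental
(or `1`). In the normal form `2^k w` of a fundamental discriminant (`w` odd square-free,
`(k, w mod 4) ∈ {(0,1), (2,3), (3,1), (3,3)}`; Cohen Def. 5.1.2; `exists_two_pow_mul_odd_of_isFundamental`):
* `mul_dvd_mul_sq_iff_odd_and_table` — **`m n ∣ d f²` iff every odd prime factor of `m` divides `d`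
  or `f`, and the DYADIC TABLE holds** (`m` odd; `4 ∥ m` and [`d` odd, `4 ∣ f`] / [`4 ∥ d`] /
  [`8 ∣ d`, `2 ∣ f`]; `8 ∣ m` and [`d` odd, `8 ∣ f`] / [`4 ∥ d`, `4 ∣ f`] / [`8 ∣ d`, `m/8 ≡ d/8 (4)`
  or `2 ∣ f`]) — the case list of Voight's Cor. 3.9; via `m n ∣ d f² ⟺ m ∣ f s` and the `2`-adic
  bookkeeping `k_d + k_m = k_n + 2 k_s`, `w_n ≡ w_d w_m (mod 4)`;
* Jacobi-symbol evaluations (Ireland–Rosen Prop. 5.2.2): `jacobiSym_eq_one_of_forall_isSquare`,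
  `jacobiSym_eq_one_of_emod_eq_one`, **`jacobiSym_two_pow_mul_eq`**:
  `(2^k w / N) = χ₈(N)^k · (1 resp. χ₄(N))` for `w ≡ 1` resp. `3 (mod 4)` when `(N / |w|) = 1`.

Mathlib / tree search: Mathlib `jacobiSym.quadratic_reciprocity_one_mod_four(')`, `…_three_mod_four`,
`jacobiSym.neg`, `jacobiSym.at_two`, `jacobiSym.mod_left`, `legendreSym.eq_one_iff`,
`Nat.exists_eq_two_pow_mul_odd`, `Nat.factorization_le_iff_dvd`, `Int.pow_dvd_pow_iff`,
`IsCoprime.mul_dvd`; tree: the fundamental-discriminant spelling of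
`QuadraticFields/FundamentalDiscriminant.lean`; `lean search 'two_pow_mul_odd|jacobiSym_two_pow'`: none.

## References

* J. Voight, *Quadratic forms that represent almost the same primes*, Math. Comp. 76 (2007),
  §3 Prop. 3.8, Cor. 3.9. [Voight2007]
* H. Cohen, *A Course in Computational Algebraic Number Theory* (1993), Def. 5.1.2. [Cohen1993]
* K. Ireland, M. Rosen, *A Classical Introduction to Modern Number Theory*, 2nd ed. (1990), Ch. 5 §2,
  Prop. 5.2.2. [IrelandRosen1990]
-/

namespace Literature.NumberTheory.EllipticCurves

namespace Voight2007

open ZMod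

/-- A fundamental discriminant `x` (or `x = 1`) is `2^k · w` with `w` odd square-free and
`(k, w mod 4) ∈ {(0, 1), (2, 3)} ∪ {3} × {1, 3}`. [cite: Cohen1993, Def. 5.1.2] -/
theorem exists_two_pow_mul_odd_of_isFundamental {x : ℤ}
    (hx : ((x % 4 = 1 ∧ Squarefree x ∧ x ≠ 1) ∨
      (4 ∣ x ∧ (x / 4 % 4 = 2 ∨ x / 4 % 4 = 3) ∧ Squarefree (x / 4))) ∨ x = 1) :
    ∃ (k : ℕ) (w : ℤ), x = 2 ^ k * w ∧ Odd w ∧ Squarefree w ∧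
      ((k = 0 ∧ w % 4 = 1) ∨ (k = 2 ∧ w % 4 = 3) ∨ k = 3) := by
  rcases hx with (⟨h4, hsq, -⟩ | ⟨⟨e, rfl⟩, he, hsq⟩) | rfl
  · refine ⟨0, x, by ring, ?_, hsq, Or.inl ⟨rfl, h4⟩⟩
    exact Int.odd_iff.mpr (by omega)
  · rw [Int.mul_ediv_cancel_left _ four_ne_zero] at he hsq
    rcases he with he | he
    · -- `e ≡ 2 (mod 4)`: `e = 2 w` with `w` odd
      obtain ⟨w, rfl⟩ : (2 : ℤ) ∣ e := Int.dvd_of_emod_eq_zero (by omega)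
      refine ⟨3, w, by ring, Int.odd_iff.mpr (by omega), ?_, Or.inr (Or.inr rfl)⟩
      exact (squarefree_mul_iff.mp hsq).2.2
    · exact ⟨2, e, by ring, Int.odd_iff.mpr (by omega), hsq, Or.inr (Or.inl ⟨rfl, he⟩)⟩
  · exact ⟨0, 1, by ring, odd_one, squarefree_one, Or.inl ⟨rfl, by norm_num⟩⟩

/-- Uniqueness of the normal form `2^k · w`, `w` odd. [folklore] -/
private theorem two_pow_mul_odd_inj {a b : ℕ} {u u' : ℤ} (hu : Odd u) (hu' : Odd u')
    (h : 2 ^ a * u = 2 ^ b * u') : a = b ∧ u = u' := by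
  wlog hab : a ≤ b generalizing a b u u'
  · have := this hu' hu h.symm (le_of_not_ge hab)
    exact ⟨this.1.symm, this.2.symm⟩
  obtain ⟨c, rfl⟩ := Nat.exists_eq_add_of_le hab
  rw [pow_add, mul_assoc] at h
  have h' : u = 2 ^ c * u' := mul_left_cancel₀ (pow_ne_zero _ two_ne_zero) h
  rcases Nat.eq_zero_or_pos c with rfl | hc
  · simp only [pow_zero, one_mul] at h'
    exact ⟨by simp, h'⟩
  · exfalso
    have h2 : (2 : ℤ) ∣ u := by
      rw [h']
      exact (dvd_pow_self 2 hc.ne').mul_right _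
    exact Int.not_even_iff_odd.mpr hu (even_iff_two_dvd.mpr h2)

/-- `2^a ∣ 2^b · u` with `u` odd iff `a ≤ b`. [folklore] -/
private theorem two_pow_dvd_two_pow_mul_odd_iff {a b : ℕ} {u : ℤ} (hu : Odd u) :
    (2 : ℤ) ^ a ∣ 2 ^ b * u ↔ a ≤ b := by
  constructor
  · intro h
    by_contra hlt
    push Not at hlt
    obtain ⟨c, rfl⟩ := Nat.exists_eq_add_of_lt hlt
    rw [show b + c + 1 = b + (c + 1) by ring, pow_add] at h
    have h' : (2 : ℤ) ^ (c + 1) ∣ u :=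
      (mul_dvd_mul_iff_left (pow_ne_zero _ (two_ne_zero : (2 : ℤ) ≠ 0))).mp h
    have h2 : (2 : ℤ) ∣ u := (dvd_pow_self 2 (Nat.succ_ne_zero c)).trans h'
    exact Int.not_even_iff_odd.mpr hu (even_iff_two_dvd.mpr h2)
  · intro hab
    exact (pow_dvd_pow 2 hab).trans (dvd_mul_right _ _)

/-- For `d m = n s²` with `d, s ≠ 0`: `m n ∣ d f² ⟺ m ∣ f s` (both say `n s ∣ d f`). [folklore] -/
private theorem mul_dvd_mul_sq_iff_dvd_mul {d m n s f : ℤ} (hd : d ≠ 0) (hs : s ≠ 0)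
    (h : d * m = n * s ^ 2) : m * n ∣ d * f ^ 2 ↔ m ∣ f * s := by
  have e1 : (n * s) ^ 2 = d * (m * n) := by
    calc (n * s) ^ 2 = n * (n * s ^ 2) := by ring
      _ = n * (d * m) := by rw [h]
      _ = d * (m * n) := by ring
  constructor
  · intro hmn
    have h1 : (n * s) ^ 2 ∣ (d * f) ^ 2 := by
      rw [e1, show (d * f) ^ 2 = d * (d * f ^ 2) by ring]
      exact mul_dvd_mul_left d hmn
    have h2 : n * s ∣ d * f := (Int.pow_dvd_pow_iff two_ne_zero).mp h1
    have h3 : n * s * s ∣ d * f * s := mul_dvd_mul_right h2 s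
    rw [show n * s * s = n * s ^ 2 by ring, ← h, show d * f * s = d * (f * s) by ring] at h3
    exact (mul_dvd_mul_iff_left hd).mp h3
  · intro hm
    have h1 : n * s ∣ d * f := by
      have := mul_dvd_mul_left d hm
      rw [h, show d * (f * s) = d * f * s by ring, show n * s ^ 2 = n * s * s by ring] at this
      exact (mul_dvd_mul_iff_right hs).mp this
    have h2 : (n * s) ^ 2 ∣ (d * f) ^ 2 := pow_dvd_pow_of_dvd h1 2
    rw [e1, show (d * f) ^ 2 = d * (d * f ^ 2) by ring] at h2
    exact (mul_dvd_mul_iff_left hd).mp h2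

/-- `2^k w ∣ X ⟺ 2^k ∣ X ∧ w ∣ X` for `w` odd. [folklore] -/
private theorem two_pow_mul_dvd_iff {k : ℕ} {w X : ℤ} (hw : Odd w) :
    2 ^ k * w ∣ X ↔ 2 ^ k ∣ X ∧ w ∣ X := by
  constructor
  · intro h
    exact ⟨(dvd_mul_right _ _).trans h, (dvd_mul_left _ _).trans h⟩
  · rintro ⟨h1, h2⟩
    obtain ⟨c, hc⟩ := hw
    have hcop : IsCoprime ((2 : ℤ) ^ k) w := IsCoprime.pow_left ⟨-c, 1, by rw [hc]; ring⟩
    exact hcop.mul_dvd h1 h2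

/-- A square-free integer divides `X ≠ 0` iff each of its prime factors does. [folklore] -/
private theorem dvd_iff_forall_prime_dvd_of_squarefree {w X : ℤ} (hw : Squarefree w) (hX : X ≠ 0) :
    w ∣ X ↔ ∀ p : ℕ, p.Prime → (p : ℤ) ∣ w → (p : ℤ) ∣ X := by
  constructor
  · intro h p _ hp
    exact hp.trans h
  · intro h
    rw [← Int.natAbs_dvd_natAbs]
    have hw0 : w.natAbs ≠ 0 := Int.natAbs_ne_zero.mpr hw.ne_zero
    have hX0 : X.natAbs ≠ 0 := Int.natAbs_ne_zero.mpr hX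
    rw [← Nat.factorization_le_iff_dvd hw0 hX0]
    intro p
    by_cases hp : p.Prime
    · have h1 : w.natAbs.factorization p ≤ 1 :=
        (Nat.squarefree_iff_factorization_le_one hw0).mp (Int.squarefree_natAbs.mpr hw) p
      by_cases hpw : p ∣ w.natAbs
      · have hpX : p ∣ X.natAbs := Int.natCast_dvd.mp (h p hp (Int.natCast_dvd.mpr hpw))
        exact h1.trans (hp.factorization_pos_of_dvd hX0 hpX)
      · rw [Nat.factorization_eq_zero_of_not_dvd hpw]
        exact Nat.zero_le _
    · rw [Nat.factorization_eq_zero_of_not_prime _ hp]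
      exact Nat.zero_le _

/-- For a prime `q ∥ m` with `q² ∤ n` and `d m = n s²`: `q ∣ s ⟺ q ∣ d`. [folklore] -/
private theorem prime_dvd_iff_of_mul_eq_mul_sq {d m n s : ℤ} {q : ℕ} (hq : q.Prime)
    (h : d * m = n * s ^ 2) (hqm : (q : ℤ) ∣ m) (hqm2 : ¬ (q : ℤ) ^ 2 ∣ m)
    (hqn2 : ¬ (q : ℤ) ^ 2 ∣ n) : (q : ℤ) ∣ s ↔ (q : ℤ) ∣ d := by
  have hQ : Prime (q : ℤ) := Nat.prime_iff_prime_int.mp hq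
  obtain ⟨m', hm'⟩ := hqm
  have hqm' : ¬ (q : ℤ) ∣ m' := by
    rintro ⟨c, hc⟩
    exact hqm2 ⟨c, by rw [hm', hc]; ring⟩
  constructor
  · intro hqs
    have h1 : (q : ℤ) ^ 2 ∣ d * m := by
      rw [h]
      exact (pow_dvd_pow_of_dvd hqs 2).mul_left n
    rw [hm', show d * ((q : ℤ) * m') = q * (d * m') by ring, sq] at h1
    have h2 : (q : ℤ) ∣ d * m' := (mul_dvd_mul_iff_left hQ.ne_zero).mp h1
    rcases hQ.dvd_or_dvd h2 with h3 | h3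
    · exact h3
    · exact absurd h3 hqm'
  · intro hqd
    by_contra hqs
    have hcop : IsCoprime ((q : ℤ) ^ 2) (s ^ 2) :=
      ((Prime.coprime_iff_not_dvd hQ).mpr hqs).pow
    have h1 : (q : ℤ) ^ 2 ∣ n * s ^ 2 := by
      rw [← h, hm', sq]
      exact mul_dvd_mul hqd (dvd_mul_right _ _)
    exact hqn2 (hcop.dvd_of_dvd_mul_right h1)

/-- **The `2`-part of `m ∣ f s`.** With `d = 2^{k_d} w_d`, `m = 2^{k_m} w_m`, `n = 2^{k_n} w_n` in
the normal form of fundamental discriminants (or `1`), `s = 2^{k_s} w_s`, `f = 2^{k_f} w_f` (`w`'s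
odd) and `d m = n s²`: `2^{k_m} ∣ f s` iff the dyadic condition of Voight's Prop. 3.8 / Cor. 3.9
(`m` odd; or `4 ∥ m` and [`d` odd, `4 ∣ f`] / [`4 ∥ d`] / [`8 ∣ d`, `2 ∣ f`]; or `8 ∣ m` and
[`d` odd, `8 ∣ f`] / [`4 ∥ d`, `4 ∣ f`] / [`8 ∣ d`, `m/8 ≡ d/8 (mod 4)` or `2 ∣ f`]). [folklore] -/
private theorem two_pow_dvd_mul_iff_table {kd km kn ks kf : ℕ} {wd wm wn ws wf : ℤ}
    (hwd : Odd wd) (hwm : Odd wm) (hwn : Odd wn) (hws : Odd ws) (hwf : Odd wf)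
    (hkd : (kd = 0 ∧ wd % 4 = 1) ∨ (kd = 2 ∧ wd % 4 = 3) ∨ kd = 3)
    (hkm : (km = 0 ∧ wm % 4 = 1) ∨ (km = 2 ∧ wm % 4 = 3) ∨ km = 3)
    (hkn : (kn = 0 ∧ wn % 4 = 1) ∨ (kn = 2 ∧ wn % 4 = 3) ∨ kn = 3)
    (h : 2 ^ kd * wd * (2 ^ km * wm) = 2 ^ kn * wn * (2 ^ ks * ws) ^ 2) :
    ((2 : ℤ) ^ km ∣ (2 ^ kf * wf) * (2 ^ ks * ws)) ↔
      (km = 0 ∨ (km = 2 ∧ ((kd = 0 ∧ 2 ≤ kf) ∨ kd = 2 ∨ (kd = 3 ∧ 1 ≤ kf))) ∨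
        (km = 3 ∧ ((kd = 0 ∧ 3 ≤ kf) ∨ (kd = 2 ∧ 2 ≤ kf) ∨
          (kd = 3 ∧ (wm % 4 = wd % 4 ∨ 1 ≤ kf))))) := by
  -- normal forms of both sides of `h`
  have h' : (2 : ℤ) ^ (kd + km) * (wd * wm) = 2 ^ (kn + 2 * ks) * (wn * ws ^ 2) := by
    rw [pow_add, pow_add, pow_mul']
    linear_combination h
  obtain ⟨hk, hw⟩ := two_pow_mul_odd_inj (hwd.mul hwm) (hwn.mul hws.pow) h'
  -- the divisibility says `km ≤ kf + ks`
  have hdiv : ((2 : ℤ) ^ km ∣ (2 ^ kf * wf) * (2 ^ ks * ws)) ↔ km ≤ kf + ks := by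
    rw [show (2 : ℤ) ^ kf * wf * (2 ^ ks * ws) = 2 ^ (kf + ks) * (wf * ws) by rw [pow_add]; ring]
    exact two_pow_dvd_two_pow_mul_odd_iff (hwf.mul hws)
  rw [hdiv]
  -- `wn ≡ wd wm (mod 4)`
  have hws2 : ws ^ 2 % 4 = 1 := by
    obtain ⟨c, hc⟩ := hws
    have : ws ^ 2 = 4 * (c ^ 2 + c) + 1 := by rw [hc]; ring
    omega
  have hwn4 : wn % 4 = wd * wm % 4 := by
    have : wd * wm % 4 = wn * ws ^ 2 % 4 := by rw [hw]
    rw [this, Int.mul_emod, hws2, mul_one, Int.emod_emod_of_dvd wn (dvd_refl 4)]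
  have hprod : wd * wm % 4 = (wd % 4) * (wm % 4) % 4 := Int.mul_emod _ _ _
  have hwd4 : wd % 4 = 1 ∨ wd % 4 = 3 := by have := Int.odd_iff.mp hwd; omega
  have hwm4 : wm % 4 = 1 ∨ wm % 4 = 3 := by have := Int.odd_iff.mp hwm; omega
  clear hdiv h h' hw hws2 hwd hwm hwn hws hwf
  rcases hwd4 with hd4 | hd4 <;> rcases hwm4 with hm4 | hm4 <;>
    · rw [hd4, hm4] at hprod
      norm_num at hprod
      rw [hprod] at hwn4
      clear hprod
      omega

/-- An odd prime `q` divides `2^k w` iff it divides `w`; and `q² ∤ 2^k w` for `w` square-free.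
[folklore] -/
private theorem odd_prime_dvd_two_pow_mul {q : ℕ} (hq : q.Prime) (hq2 : q ≠ 2) (k : ℕ) (w : ℤ) :
    ((q : ℤ) ∣ 2 ^ k * w ↔ (q : ℤ) ∣ w) ∧ (Squarefree w → ¬ (q : ℤ) ^ 2 ∣ 2 ^ k * w) := by
  have hQ : Prime (q : ℤ) := Nat.prime_iff_prime_int.mp hq
  have hq2' : ¬ (q : ℤ) ∣ 2 := by
    intro h2
    have h3 : q ∣ 2 := by exact_mod_cast h2
    rcases (Nat.dvd_prime Nat.prime_two).mp h3 with h4 | h4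
    · exact hq.one_lt.ne' h4
    · exact hq2 h4
  have hcop : IsCoprime (q : ℤ) (2 ^ k) := ((Prime.coprime_iff_not_dvd hQ).mpr hq2').pow_right
  refine ⟨⟨fun h => hcop.dvd_of_dvd_mul_left h, fun h => h.mul_left _⟩, fun hsq h => ?_⟩
  have h1 : (q : ℤ) ^ 2 ∣ w := hcop.pow_left.dvd_of_dvd_mul_left h
  have hu : IsUnit (q : ℤ) := hsq (q : ℤ) (by rw [← sq]; exact h1)
  exact hQ.not_unit hu

/-- **Voight's divisibility `m n ∣ d f²`, made explicit.** For fundamental discriminants `d, m` and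
`n` fundamental or `1` in normal form (`d = 2^{k_d} w_d`, …) with `d m = n s²`, `f ≥ 1`:
`m n ∣ d f²` iff every odd prime factor of `m` divides `d` or `f`, and the dyadic condition holds
(the case list of Cor. 3.9). [cite: Voight2007, §3 Prop. 3.8 and Cor. 3.9] -/
theorem mul_dvd_mul_sq_iff_odd_and_table {d m n s : ℤ} {f : ℕ} (hf : f ≠ 0) (hd : d ≠ 0)
    {kd km kn : ℕ} {wd wm wn : ℤ} (hdd : d = 2 ^ kd * wd) (hmd : m = 2 ^ km * wm)
    (hnd : n = 2 ^ kn * wn) (hwd : Odd wd) (hwm : Odd wm) (hwn : Odd wn)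
    (hsqm : Squarefree wm) (hsqn : Squarefree wn)
    (hkd : (kd = 0 ∧ wd % 4 = 1) ∨ (kd = 2 ∧ wd % 4 = 3) ∨ kd = 3)
    (hkm : (km = 0 ∧ wm % 4 = 1) ∨ (km = 2 ∧ wm % 4 = 3) ∨ km = 3)
    (hkn : (kn = 0 ∧ wn % 4 = 1) ∨ (kn = 2 ∧ wn % 4 = 3) ∨ kn = 3)
    (h : d * m = n * s ^ 2) :
    m * n ∣ d * (f : ℤ) ^ 2 ↔
      (∀ q : ℕ, q.Prime → q ≠ 2 → (q : ℤ) ∣ m → (q : ℤ) ∣ d ∨ q ∣ f) ∧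
      (km = 0 ∨ (km = 2 ∧ ((kd = 0 ∧ 4 ∣ f) ∨ kd = 2 ∨ (kd = 3 ∧ 2 ∣ f))) ∨
        (km = 3 ∧ ((kd = 0 ∧ 8 ∣ f) ∨ (kd = 2 ∧ 4 ∣ f) ∨
          (kd = 3 ∧ (wm % 4 = wd % 4 ∨ 2 ∣ f))))) := by
  have hwm0 : wm ≠ 0 := by rintro rfl; exact absurd hwm (by decide)
  have hm0 : m ≠ 0 := by rw [hmd]; exact mul_ne_zero (pow_ne_zero _ two_ne_zero) hwm0
  have hs : s ≠ 0 := by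
    rintro rfl
    exact mul_ne_zero hd hm0 (by rw [h]; ring)
  -- normal forms of `|s|` and `f`
  obtain ⟨ks, ws', hws', hsdef⟩ := Nat.exists_eq_two_pow_mul_odd (Int.natAbs_ne_zero.mpr hs)
  obtain ⟨kf, wf', hwf', hfdef⟩ := Nat.exists_eq_two_pow_mul_odd hf
  set S : ℤ := (s.natAbs : ℤ) with hSdef
  have hS : S = 2 ^ ks * (ws' : ℤ) := by rw [hSdef, hsdef]; push_cast; ring
  have hws : Odd (ws' : ℤ) := by exact_mod_cast hws'
  have hwf : Odd (wf' : ℤ) := by exact_mod_cast hwf'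
  have hF : (f : ℤ) = 2 ^ kf * (wf' : ℤ) := by rw [hfdef]; push_cast; ring
  have hS2 : s ^ 2 = S ^ 2 := by rw [hSdef, Int.natAbs_sq]
  rw [hS2] at h
  have hS0 : S ≠ 0 := by rw [hSdef]; exact_mod_cast Int.natAbs_ne_zero.mpr hs
  have hfS0 : (f : ℤ) * S ≠ 0 := mul_ne_zero (by exact_mod_cast hf) hS0
  -- `q ∥ m`, `q² ∤ n` for odd primes `q ∣ m`
  have hqm : ∀ q : ℕ, q.Prime → q ≠ 2 → (q : ℤ) ∣ m →
      (q : ℤ) ∣ wm ∧ ¬ (q : ℤ) ^ 2 ∣ m ∧ ¬ (q : ℤ) ^ 2 ∣ n := by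
    intro q hq hq2 hqm
    obtain ⟨h1, h2⟩ := odd_prime_dvd_two_pow_mul hq hq2 km wm
    obtain ⟨-, h3⟩ := odd_prime_dvd_two_pow_mul hq hq2 kn wn
    rw [hmd] at hqm ⊢
    rw [hnd]
    exact ⟨h1.mp hqm, h2 hsqm, h3 hsqn⟩
  -- odd part
  have hodd_iff : wm ∣ (f : ℤ) * S ↔
      (∀ q : ℕ, q.Prime → q ≠ 2 → (q : ℤ) ∣ m → (q : ℤ) ∣ d ∨ q ∣ f) := by
    constructor
    · intro hw q hq hq2 hqdm
      have hQ : Prime (q : ℤ) := Nat.prime_iff_prime_int.mp hq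
      obtain ⟨hqw, hqm2, hqn2⟩ := hqm q hq hq2 hqdm
      rcases hQ.dvd_or_dvd (hqw.trans hw) with h1 | h1
      · exact Or.inr (by exact_mod_cast h1)
      · exact Or.inl ((prime_dvd_iff_of_mul_eq_mul_sq hq h hqdm hqm2 hqn2).mp h1)
    · intro H
      rw [dvd_iff_forall_prime_dvd_of_squarefree hsqm hfS0]
      intro q hq hqw
      have hq2 : q ≠ 2 := by
        rintro rfl
        exact Int.not_even_iff_odd.mpr hwm (even_iff_two_dvd.mpr (by exact_mod_cast hqw))
      have hqdm : (q : ℤ) ∣ m := by rw [hmd]; exact hqw.mul_left _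
      obtain ⟨-, hqm2, hqn2⟩ := hqm q hq hq2 hqdm
      rcases H q hq hq2 hqdm with h1 | h1
      · exact ((prime_dvd_iff_of_mul_eq_mul_sq hq h hqdm hqm2 hqn2).mpr h1).mul_left _
      · exact (show (q : ℤ) ∣ (f : ℤ) by exact_mod_cast h1).mul_right _
  -- dyadic part
  have h2f : ∀ j : ℕ, 2 ^ j ∣ f ↔ j ≤ kf := fun j => by
    rw [← Int.natCast_dvd_natCast]
    push_cast
    rw [hF]
    exact two_pow_dvd_two_pow_mul_odd_iff hwf
  have h4 : 4 ∣ f ↔ 2 ≤ kf := by rw [show (4 : ℕ) = 2 ^ 2 by norm_num]; exact h2f 2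
  have h8 : 8 ∣ f ↔ 3 ≤ kf := by rw [show (8 : ℕ) = 2 ^ 3 by norm_num]; exact h2f 3
  have h2 : 2 ∣ f ↔ 1 ≤ kf := by rw [show (2 : ℕ) = 2 ^ 1 by norm_num]; exact h2f 1
  have htwo_iff : ((2 : ℤ) ^ km ∣ (f : ℤ) * S) ↔
      (km = 0 ∨ (km = 2 ∧ ((kd = 0 ∧ 4 ∣ f) ∨ kd = 2 ∨ (kd = 3 ∧ 2 ∣ f))) ∨
        (km = 3 ∧ ((kd = 0 ∧ 8 ∣ f) ∨ (kd = 2 ∧ 4 ∣ f) ∨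
          (kd = 3 ∧ (wm % 4 = wd % 4 ∨ 2 ∣ f))))) := by
    have hrel : 2 ^ kd * wd * (2 ^ km * wm) = 2 ^ kn * wn * (2 ^ ks * (ws' : ℤ)) ^ 2 := by
      rw [← hdd, ← hmd, ← hnd, ← hS]
      exact h
    rw [hF, hS, two_pow_dvd_mul_iff_table hwd hwm hwn hws hwf hkd hkm hkn hrel]
    simp only [h4, h8, h2]
  -- assemble
  have hsplit : m ∣ (f : ℤ) * S ↔ (2 : ℤ) ^ km ∣ (f : ℤ) * S ∧ wm ∣ (f : ℤ) * S := by
    rw [hmd]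
    exact two_pow_mul_dvd_iff hwm
  rw [mul_dvd_mul_sq_iff_dvd_mul hd hS0 h, hsplit, htwo_iff, hodd_iff, and_comm]

/-- If `a` is a non-zero square modulo every prime factor of `b`, then `(a / b) = 1` (the Jacobi
symbol is the product of the Legendre symbols). [cite: IrelandRosen1990, Ch. 5 §2 (definition of the Jacobi symbol) and Prop. 5.2.2] -/
theorem jacobiSym_eq_one_of_forall_isSquare {a : ℤ} {b : ℕ}
    (h : ∀ p : ℕ, p.Prime → p ∣ b → (a : ZMod p) ≠ 0 ∧ IsSquare (a : ZMod p)) :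
    jacobiSym a b = 1 := by
  unfold jacobiSym
  apply List.prod_eq_one
  intro x hx
  rw [List.mem_pmap] at hx
  obtain ⟨p, hp, rfl⟩ := hx
  have hpp : p.Prime := Nat.prime_of_mem_primeFactorsList hp
  haveI : Fact p.Prime := ⟨hpp⟩
  obtain ⟨h0, hsq⟩ := h p hpp (Nat.dvd_of_mem_primeFactorsList hp)
  exact (legendreSym.eq_one_iff p h0).mpr hsq

/-- **`(w / N)` for `N ≡ □ (mod |w|)`:** for odd `w ∈ ℤ` and odd `N ∈ ℕ` with `(N / |w|) = 1`,
`(w / N) = 1` if `w ≡ 1 (mod 4)` and `(w / N) = χ₄(N)` if `w ≡ 3 (mod 4)` (quadratic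
reciprocity for the Jacobi symbol and `(−1 / N) = χ₄(N)`). [cite: IrelandRosen1990, Ch. 5 §2 Prop. 5.2.2] -/
theorem jacobiSym_odd_eq_of_jacobiSym_natAbs_eq_one {w : ℤ} (hw : Odd w) {N : ℕ} (hN : Odd N)
    (hJ : jacobiSym (N : ℤ) w.natAbs = 1) :
    jacobiSym w N = if w % 4 = 1 then 1 else χ₄ N := by
  have hW : Odd w.natAbs := Int.natAbs_odd.mpr hw
  have hWN : jacobiSym (w.natAbs : ℤ) N = if w.natAbs % 4 = 1 then 1 else χ₄ N := by
    rcases Nat.odd_mod_four_iff.mp (Nat.odd_iff.mp hW) with h1 | h3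
    · rw [if_pos h1, jacobiSym.quadratic_reciprocity_one_mod_four h1 hN, hJ]
    · rw [if_neg (by omega)]
      rcases Nat.odd_mod_four_iff.mp (Nat.odd_iff.mp hN) with hN1 | hN3
      · rw [jacobiSym.quadratic_reciprocity_one_mod_four' hW hN1, hJ, χ₄_nat_one_mod_four hN1]
      · rw [jacobiSym.quadratic_reciprocity_three_mod_four h3 hN3, hJ, χ₄_nat_three_mod_four hN3]
  have hχ : χ₄ (N : ZMod 4) * χ₄ (N : ZMod 4) = 1 := by
    rcases Nat.odd_mod_four_iff.mp (Nat.odd_iff.mp hN) with hN1 | hN3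
    · rw [χ₄_nat_one_mod_four hN1]; norm_num
    · rw [χ₄_nat_three_mod_four hN3]; norm_num
  set W : ℕ := w.natAbs with hWdef
  rcases Int.natAbs_eq w with hpos | hneg
  · rw [hpos, hWN]
    split_ifs with h1 h2 h2 <;> first | rfl | (exfalso; omega)
  · rw [hneg, jacobiSym.neg _ hN, hWN]
    rcases Nat.odd_mod_four_iff.mp (Nat.odd_iff.mp hW) with h1 | h3
    · rw [if_pos h1, if_neg (by omega), mul_one]
    · rw [if_neg (by omega), if_pos (by omega), hχ]

/-- **`(2^k w / N)`:** for odd `w`, odd `N` with `(N / |w|) = 1`: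
`(2^k w / N) = χ₈(N)^k · (1 or χ₄(N))` according as `w ≡ 1` or `3 (mod 4)`
(`(2/N) = χ₈(N)` and quadratic reciprocity). [cite: IrelandRosen1990, Ch. 5 §2 Prop. 5.2.2] -/
theorem jacobiSym_two_pow_mul_eq {k : ℕ} {w : ℤ} (hw : Odd w) {N : ℕ} (hN : Odd N)
    (hJ : jacobiSym (N : ℤ) w.natAbs = 1) :
    jacobiSym (2 ^ k * w) N = (χ₈ N) ^ k * (if w % 4 = 1 then 1 else χ₄ N) := by
  rw [jacobiSym.mul_left, jacobiSym.pow_left, jacobiSym.at_two hN,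
    jacobiSym_odd_eq_of_jacobiSym_natAbs_eq_one hw hN hJ]

/-- `(N / b) = 1` when `N ≡ 1 (mod b)` (`(a₁/b) = (a₂/b)` for `a₁ ≡ a₂ (mod b)`).
[cite: IrelandRosen1990, Ch. 5 §2 Prop. 5.2.2] -/
theorem jacobiSym_eq_one_of_emod_eq_one {N : ℤ} {b : ℕ} (h : N % b = 1 % b) :
    jacobiSym N b = 1 := by
  rw [jacobiSym.mod_left, h, ← jacobiSym.mod_left, jacobiSym.one_left]

end Voight2007

end Literature.NumberTheory.EllipticCurves
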